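import Summits.QuantumFields.YangMills.Theorems.CurvatureBoostCovariance.Negative.Unbundled
import Summits.QuantumFields.YangMills.Theorems.NPointIsotropy.Negative.NPointRegularJunk
import Summits.QuantumFields.YangMills.Theorems.MirrorModularBoostsCurvatureBoostCovarianceRayPositivityCore
import Summits.QuantumFields.YangMills.Theorems.MirrorModularBoostsPlanarSpectralConeDensityHelpers
import Literature.MathematicalPhysics.QuantumFieldTheory.OSReconstructionNoE1

/-!
# Assembly piece S2 — the height-dependent sandwich constants; rotated bump tensors; tail tensors as Schwartz maps

Line `Sketch` of crux `MirrorModularBoosts.SoftKernelBoostCovariance` (stmt-QuantumFields-14999): a piece of the LEAD'S ASSEMBLY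
(T7, `stub_chainAssembly` of the registered skeleton `Cruxes/SoftKernelBoostCovariance/Lines/Sketch.lean` + `Lines/SketchAsm.lean`),
landed under the registered conjunction `stub_asmConstantsAndBumps` (helper package; the assembly's later pieces import this module).

Exported: `sandwichConst_pow_le` (type `n|μ|`), `sandwichConst_le_type` (type exactly `μ`), `cfg_zero_eq`, `rot_bump_apply`,
`exists_bumpTensor_asm`, `three_quarters_le_exp_neg_quarter`, `sub_smul_single_zero_apply`.
-/

noncomputable section

namespace Summit.QuantumFields.YangMills.Theorems.SoftKernelBoostCovariance.Sketch

open scoped BigOperators SchwartzMap InnerProductSpace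
open MeasureTheory Filter Topology
open Literature.MathematicalPhysics.QuantumLattice Literature.MathematicalPhysics.AQFT
  Literature.MathematicalPhysics.QuantumFieldTheory
open Summit.QuantumFields.YangMills.Theorems.NPointIsotropy.Negative (E4)
open Summit.QuantumFields.YangMills.Theorems.CurvatureBoostCovariance.Negative
  (OSPackage Translations Hypercubic EightFrameRP PlanarCone PlanarInvariant)
open Summit.QuantumFields.YangMills.Cruxes.PlanarSpectralCone.PositivityDiscToOperatorCone.Density
  (isTimeOrdered_add fieldVec_add fieldVec_smul fieldVec_congr fieldVec_zero tendsto_fieldVec)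

/-- Coordinates of `x 0 - a • e₀`. -/
theorem sub_smul_single_zero_apply (y : E4) (a : ℝ) (k : Fin 4) :
    (y - a • EuclideanSpace.single (0 : Fin 4) (1 : ℝ)) k = y k - (if k = 0 then a else 0) := by
  simp

/-- **The constant of the sandwich bound at reserve `u = e^{-m} u₁`**: polynomial-in-`e^{m}` control,
`max (C·1·(A+A)·(u^{-μ}+u^{-μ})) 0 ≤ (4 |C| |A| u₁^{-μ}) · e^{|μ| m}`. -/
theorem sandwichConst_le {C A μ u₁ : ℝ} (hu₁ : 0 < u₁) (m : ℝ) (hm : 0 ≤ m) :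
    max (C * 1 * (A + A) * ((Real.exp (-m) * u₁) ^ (-μ) + (Real.exp (-m) * u₁) ^ (-μ))) 0 ≤
      (4 * |C| * |A| * u₁ ^ (-μ)) * Real.exp (|μ| * m) := by
  have hu : 0 < Real.exp (-m) * u₁ := by positivity
  have hpow : (Real.exp (-m) * u₁) ^ (-μ) = Real.exp (μ * m) * u₁ ^ (-μ) := by
    rw [Real.mul_rpow (Real.exp_pos _).le hu₁.le, ← Real.exp_mul]
    ring_nf
  have hexp : Real.exp (μ * m) ≤ Real.exp (|μ| * m) :=
    Real.exp_le_exp.2 (mul_le_mul_of_nonneg_right (le_abs_self μ) hm)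
  have hnn : 0 ≤ 4 * |C| * |A| * u₁ ^ (-μ) * Real.exp (|μ| * m) := by positivity
  refine max_le ?_ hnn
  rw [hpow]
  have hCA : C * 1 * (A + A) ≤ 2 * |C| * |A| := by
    have h1 : C * 1 * (A + A) = 2 * (C * A) := by ring
    rw [h1, mul_assoc 2]
    exact mul_le_mul_of_nonneg_left ((le_abs_self _).trans_eq (abs_mul C A)) (by norm_num)
  have hsum : Real.exp (μ * m) * u₁ ^ (-μ) + Real.exp (μ * m) * u₁ ^ (-μ) ≤ 2 * (u₁ ^ (-μ) * Real.exp (|μ| * m)) := by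
    have := Real.rpow_pos_of_pos hu₁ (-μ)
    nlinarith
  calc C * 1 * (A + A) * (Real.exp (μ * m) * u₁ ^ (-μ) + Real.exp (μ * m) * u₁ ^ (-μ))
      ≤ (2 * |C| * |A|) * (2 * (u₁ ^ (-μ) * Real.exp (|μ| * m))) := by
        apply mul_le_mul hCA hsum (by positivity) (by positivity)
    _ = 4 * |C| * |A| * u₁ ^ (-μ) * Real.exp (|μ| * m) := by ring

/-- Powers of the height-dependent sandwich constant grow at most exponentially in the height. -/
theorem sandwichConst_pow_le {C A μ u₁ : ℝ} (hu₁ : 0 < u₁) (n : ℕ) {m y : ℝ} (hm : 0 ≤ m) (hmy : m ≤ y + 1) (_hy : 0 ≤ y) :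
    (max (C * 1 * (A + A) * ((Real.exp (-m) * u₁) ^ (-μ) + (Real.exp (-m) * u₁) ^ (-μ))) 0) ^ n ≤
      ((4 * |C| * |A| * u₁ ^ (-μ)) * Real.exp |μ|) ^ n * Real.exp ((n : ℝ) * |μ| * y) := by
  have h1 := sandwichConst_le (C := C) (A := A) (μ := μ) hu₁ m hm
  have h2 : Real.exp (|μ| * m) ≤ Real.exp |μ| * Real.exp (|μ| * y) := by
    rw [← Real.exp_add]; exact Real.exp_le_exp.2 (by nlinarith [abs_nonneg μ])
  have hB : 0 ≤ 4 * |C| * |A| * u₁ ^ (-μ) := by positivity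
  have h3 : max (C * 1 * (A + A) * ((Real.exp (-m) * u₁) ^ (-μ) + (Real.exp (-m) * u₁) ^ (-μ))) 0 ≤
      (4 * |C| * |A| * u₁ ^ (-μ) * Real.exp |μ|) * Real.exp (|μ| * y) := by
    calc _ ≤ (4 * |C| * |A| * u₁ ^ (-μ)) * Real.exp (|μ| * m) := h1
      _ ≤ (4 * |C| * |A| * u₁ ^ (-μ)) * (Real.exp |μ| * Real.exp (|μ| * y)) := by gcongr
      _ = _ := by ring
  calc _ ≤ ((4 * |C| * |A| * u₁ ^ (-μ) * Real.exp |μ|) * Real.exp (|μ| * y)) ^ n :=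
        pow_le_pow_left₀ (le_max_right _ _) h3 n
    _ = _ := by
        rw [mul_pow, ← Real.exp_nat_mul]; ring_nf

/-- The configuration seen from the reference `q = 0`, `w = 0` is the rotated test function itself. -/
theorem cfg_zero_eq {N' : ℕ} (θ : ℝ) (X : 𝓢((Fin N' → E4), ℂ)) :
    translateMulti
        (-((Real.cos θ * ((0 : ℝ), (0 : ℝ)).1 + Real.sin θ * ((0 : ℝ), (0 : ℝ)).2 + 0) • EuclideanSpace.single 0 1 +
          (-Real.sin θ * ((0 : ℝ), (0 : ℝ)).1 + Real.cos θ * ((0 : ℝ), (0 : ℝ)).2) • EuclideanSpace.single 1 1))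
        (linActMulti (planeRot (0 : Fin 3) θ) X) = linActMulti (planeRot (0 : Fin 3) θ) X := by
  have : (-((Real.cos θ * ((0 : ℝ), (0 : ℝ)).1 + Real.sin θ * ((0 : ℝ), (0 : ℝ)).2 + 0) •
      (EuclideanSpace.single 0 1 : E4) +
      (-Real.sin θ * ((0 : ℝ), (0 : ℝ)).1 + Real.cos θ * ((0 : ℝ), (0 : ℝ)).2) • EuclideanSpace.single 1 1)) = 0 := by
    simp
  rw [this, translateMulti_zero]

/-- The planar rotation is an isometry, in coordinates: `|R_θ⁻¹ y - c|² = |y - R_θ c|²`.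
-- adapted from the wave-4 worker's `rot_sq_identity` (work/stubs/BumpChainFromLink.lean) -/
theorem rot_sq_identity_asm (θ y₀ y₁ c₁ c₂ : ℝ) :
    (Real.cos θ * y₀ - Real.sin θ * y₁ - c₁) ^ 2 + (Real.sin θ * y₀ + Real.cos θ * y₁ - c₂) ^ 2 =
      (y₀ - (Real.cos θ * c₁ + Real.sin θ * c₂)) ^ 2 + (y₁ - (-Real.sin θ * c₁ + Real.cos θ * c₂)) ^ 2 := by
  linear_combination (y₀ ^ 2 + y₁ ^ 2 - c₁ ^ 2 - c₂ ^ 2) * Real.cos_sq_add_sin_sq θ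

/-- Coordinates of `R_θ⁻¹ y` on `ℝ⁴`. -/
theorem planeRot_symm_coord_asm (θ : ℝ) (y : E4) :
    (planeRot (0 : Fin 3) θ).symm y 0 = Real.cos θ * y 0 - Real.sin θ * y 1 ∧
    (planeRot (0 : Fin 3) θ).symm y 1 = Real.sin θ * y 0 + Real.cos θ * y 1 ∧
    (planeRot (0 : Fin 3) θ).symm y 2 = y 2 ∧ (planeRot (0 : Fin 3) θ).symm y 3 = y 3 := by
  refine ⟨?_, ?_, ?_, ?_⟩ <;> simp [planeRot_symm_apply, planeRot_apply, sub_eq_add_neg]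

/-- **Rotating a radial-bump tensor moves its centres and nothing else.** -/
theorem rot_bump_apply {n : ℕ} (φ : ℝ → ℂ) (hh : Fin n → ℝ × ℝ → ℂ) (c : Fin n → ℝ × ℝ) (T : 𝓢((Fin n → E4), ℂ))
    (hT : ∀ x : Fin n → E4, T x = ∏ j, φ ((x j 0 - (c j).1) ^ 2 + (x j 1 - (c j).2) ^ 2) * hh j (x j 2, x j 3))
    (θ : ℝ) (x : Fin n → E4) :
    linActMulti (planeRot (0 : Fin 3) θ) T x =
      ∏ j, φ ((x j 0 - (Real.cos θ * (c j).1 + Real.sin θ * (c j).2)) ^ 2 +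
        (x j 1 - (-Real.sin θ * (c j).1 + Real.cos θ * (c j).2)) ^ 2) * hh j (x j 2, x j 3) := by
  rw [linActMulti_apply, hT]
  refine Finset.prod_congr rfl fun j _ => ?_
  obtain ⟨h0, h1, h2, h3⟩ := planeRot_symm_coord_asm θ (x j)
  rw [h0, h1, h2, h3, rot_sq_identity_asm]

/-- A radial item with prescribed planar centre, as a one-point test function on `ℝ⁴`, from the item `f0` on
`(ℝ⁴)¹` centred at the planar origin.  -- adapted from the wave-4 worker's `exists_item` -/
theorem exists_item_asm (φ : ℝ → ℂ) (hh : ℝ × ℝ → ℂ) (f0 : 𝓢((Fin 1 → E4), ℂ)) (c : ℝ × ℝ)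
    (hf0 : ∀ x : Fin 1 → E4, f0 x = φ ((x 0 0) ^ 2 + (x 0 1) ^ 2) * hh (x 0 2, x 0 3)) :
    ∃ g : 𝓢(E4, ℂ), ∀ z : E4, g z = φ ((z 0 - c.1) ^ 2 + (z 1 - c.2) ^ 2) * hh (z 2, z 3) := by
  refine ⟨translateTest (c.1 • EuclideanSpace.single 0 1 + c.2 • EuclideanSpace.single 1 1)
    (SchwartzMap.compCLMOfContinuousLinearEquiv ℂ (ContinuousLinearEquiv.funUnique (Fin 1) ℝ E4).symm f0),
    fun z => ?_⟩
  rw [translateTest_apply, SchwartzMap.compCLMOfContinuousLinearEquiv_apply, Function.comp_apply,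
    ContinuousLinearEquiv.coe_funUnique_symm, hf0]
  simp

/-- Bump tensors with prescribed centres exist as Schwartz maps (`SchwartzMap.tensorFin` of the items). -/
theorem exists_bumpTensor_asm {k : ℕ} (φ : ℝ → ℂ) (hh : Fin k → ℝ × ℝ → ℂ) (f0 : Fin k → 𝓢((Fin 1 → E4), ℂ))
    (c : Fin k → ℝ × ℝ)
    (hf0 : ∀ (j : Fin k) (x : Fin 1 → E4), f0 j x = φ ((x 0 0) ^ 2 + (x 0 1) ^ 2) * hh j (x 0 2, x 0 3)) :
    ∃ T : 𝓢((Fin k → E4), ℂ), ∀ x : Fin k → E4,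
      T x = ∏ j, φ ((x j 0 - (c j).1) ^ 2 + (x j 1 - (c j).2) ^ 2) * hh j (x j 2, x j 3) := by
  choose g hg using fun j => exists_item_asm φ (hh j) (f0 j) (c j) (hf0 j)
  exact ⟨SchwartzMap.tensorFin k g, fun x => by simp only [SchwartzMap.tensorFin_apply, hg]⟩

/-- **The sandwich constant at reserve `e^{-m'} u₁` has TYPE `μ`**: for `m' - 1 ≤ y < m'` (any sign of `μ`),
`max (C·1·(A+A)·(u^{-μ}+u^{-μ})) 0 ≤ (4|C||A|u₁^{-μ} e^{|μ|}) · e^{μ y}`. -/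
theorem sandwichConst_le_type {C A μ u₁ : ℝ} (hu₁ : 0 < u₁) {m' y : ℝ} (hy1 : m' ≤ y + 1) (hy2 : y ≤ m') :
    max (C * 1 * (A + A) * ((Real.exp (-m') * u₁) ^ (-μ) + (Real.exp (-m') * u₁) ^ (-μ))) 0 ≤
      (4 * |C| * |A| * u₁ ^ (-μ) * Real.exp |μ|) * Real.exp (μ * y) := by
  have hu : 0 < Real.exp (-m') * u₁ := by positivity
  have hpow : (Real.exp (-m') * u₁) ^ (-μ) = Real.exp (μ * m') * u₁ ^ (-μ) := by
    rw [Real.mul_rpow (Real.exp_pos _).le hu₁.le, ← Real.exp_mul]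
    ring_nf
  have hexp : Real.exp (μ * m') ≤ Real.exp |μ| * Real.exp (μ * y) := by
    rw [← Real.exp_add]
    refine Real.exp_le_exp.2 ?_
    rcases le_or_gt 0 μ with hμ | hμ
    · rw [abs_of_nonneg hμ]; nlinarith
    · rw [abs_of_neg hμ]; nlinarith
  have hnn : 0 ≤ 4 * |C| * |A| * u₁ ^ (-μ) * Real.exp |μ| * Real.exp (μ * y) := by positivity
  refine max_le ?_ hnn
  rw [hpow]
  have hCA : C * 1 * (A + A) ≤ 2 * |C| * |A| := by
    have h1 : C * 1 * (A + A) = 2 * (C * A) := by ring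
    rw [h1, mul_assoc 2]
    exact mul_le_mul_of_nonneg_left ((le_abs_self _).trans_eq (abs_mul C A)) (by norm_num)
  have hsum : Real.exp (μ * m') * u₁ ^ (-μ) + Real.exp (μ * m') * u₁ ^ (-μ) ≤
      2 * (u₁ ^ (-μ) * (Real.exp |μ| * Real.exp (μ * y))) := by
    have := Real.rpow_pos_of_pos hu₁ (-μ)
    nlinarith
  calc C * 1 * (A + A) * (Real.exp (μ * m') * u₁ ^ (-μ) + Real.exp (μ * m') * u₁ ^ (-μ))
      ≤ (2 * |C| * |A|) * (2 * (u₁ ^ (-μ) * (Real.exp |μ| * Real.exp (μ * y)))) :=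
        mul_le_mul hCA hsum (by positivity) (by positivity)
    _ = 4 * |C| * |A| * u₁ ^ (-μ) * Real.exp |μ| * Real.exp (μ * y) := by ring

/-- `e^{-1/4} ≥ 3/4`. -/
theorem three_quarters_le_exp_neg_quarter : (3 : ℝ) / 4 ≤ Real.exp (-(1 / 4)) := by
  have := Real.add_one_le_exp (-(1 / 4 : ℝ)); linarith

/-- **Registered helper package `stub_asmConstantsAndBumps` of the lead's assembly (line `Sketch`)**: the conjunction of
`sandwichConst_pow_le`, `sandwichConst_le_type`, `cfg_zero_eq`, `rot_bump_apply`, `exists_bumpTensor_asm`. -/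
theorem stub_asmConstantsAndBumps :
    open Literature.MathematicalPhysics.QuantumLattice Literature.MathematicalPhysics.AQFT
      Literature.MathematicalPhysics.QuantumFieldTheory
      Summit.QuantumFields.YangMills.Theorems.CurvatureBoostCovariance.Negative
      Summit.QuantumFields.YangMills.Theorems.NPointIsotropy.Negative in
    (∀ {C A μ u₁ : ℝ} (hu₁ : 0 < u₁) (n : ℕ) {m y : ℝ} (hm : 0 ≤ m) (hmy : m ≤ y + 1) (_hy : 0 ≤ y),
      (max (C * 1 * (A + A) * ((Real.exp (-m) * u₁) ^ (-μ) + (Real.exp (-m) * u₁) ^ (-μ))) 0) ^ n ≤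
          ((4 * |C| * |A| * u₁ ^ (-μ)) * Real.exp |μ|) ^ n * Real.exp ((n : ℝ) * |μ| * y)) ∧
    (∀ {C A μ u₁ : ℝ} (hu₁ : 0 < u₁) {m' y : ℝ} (hy1 : m' ≤ y + 1) (hy2 : y ≤ m'),
      max (C * 1 * (A + A) * ((Real.exp (-m') * u₁) ^ (-μ) + (Real.exp (-m') * u₁) ^ (-μ))) 0 ≤
          (4 * |C| * |A| * u₁ ^ (-μ) * Real.exp |μ|) * Real.exp (μ * y)) ∧
    (∀ {N' : ℕ} (θ : ℝ) (X : 𝓢((Fin N' → E4), ℂ)),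
      translateMulti
            (-((Real.cos θ * ((0 : ℝ), (0 : ℝ)).1 + Real.sin θ * ((0 : ℝ), (0 : ℝ)).2 + 0) • EuclideanSpace.single 0 1 +
              (-Real.sin θ * ((0 : ℝ), (0 : ℝ)).1 + Real.cos θ * ((0 : ℝ), (0 : ℝ)).2) • EuclideanSpace.single 1 1))
            (linActMulti (planeRot (0 : Fin 3) θ) X) = linActMulti (planeRot (0 : Fin 3) θ) X) ∧
    (∀ {n : ℕ} (φ : ℝ → ℂ) (hh : Fin n → ℝ × ℝ → ℂ) (c : Fin n → ℝ × ℝ) (T : 𝓢((Fin n → E4), ℂ)) (hT : ∀ x : Fin n → E4, T x = ∏ j, φ ((x j 0 - (c j).1) ^ 2 + (x j 1 - (c j).2) ^ 2) * hh j (x j 2, x j 3)) (θ : ℝ) (x : Fin n → E4),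
      linActMulti (planeRot (0 : Fin 3) θ) T x =
          ∏ j, φ ((x j 0 - (Real.cos θ * (c j).1 + Real.sin θ * (c j).2)) ^ 2 +
            (x j 1 - (-Real.sin θ * (c j).1 + Real.cos θ * (c j).2)) ^ 2) * hh j (x j 2, x j 3)) ∧
    (∀ {k : ℕ} (φ : ℝ → ℂ) (hh : Fin k → ℝ × ℝ → ℂ) (f0 : Fin k → 𝓢((Fin 1 → E4), ℂ)) (c : Fin k → ℝ × ℝ) (hf0 : ∀ (j : Fin k) (x : Fin 1 → E4), f0 j x = φ ((x 0 0) ^ 2 + (x 0 1) ^ 2) * hh j (x 0 2, x 0 3)),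
      ∃ T : 𝓢((Fin k → E4), ℂ), ∀ x : Fin k → E4,
          T x = ∏ j, φ ((x j 0 - (c j).1) ^ 2 + (x j 1 - (c j).2) ^ 2) * hh j (x j 2, x j 3)) :=
  ⟨@sandwichConst_pow_le, @sandwichConst_le_type, @cfg_zero_eq, @rot_bump_apply, @exists_bumpTensor_asm⟩

end Summit.QuantumFields.YangMills.Theorems.SoftKernelBoostCovariance.Sketch

end
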